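import Mathlib
import Literature.RepresentationTheory.FiniteGroups.InducedClassFunction
import Literature.RepresentationTheory.FiniteGroups.BrauerInduction
import Literature.RepresentationTheory.FiniteGroups.BrauerTheorem
import Literature.RepresentationTheory.FiniteGroups.MonomialRepresentation
import Summits.MatrixMultiplication.MatrixMultiplication.Theorems.LieRankDesigns.Negative.Basics
import Summits.MatrixMultiplication.MatrixMultiplication.Theorems.SubgroupIdentityDesigns.Negative.GrassmannOrbits
import Summits.MatrixMultiplication.MatrixMultiplication.Theorems.SubgroupIdentityDesigns.Negative.FlagCharacter

/-!
# `⟨Ψ, Ψ⟩ ≤ (k+1)^k` for the permutation character on partial flags of type `(1^k; l)`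

Orbit count for the sharper general-`k` budget lemma (crux `SubgroupIdentityDesigns`,
stmt-MatrixMultiplication-14079; BLOCK-SLICES §2).  VALUE = theorem, NOT summit progress.

With `P' = flagStab F k l` and `Ψ = flagChar F k l = Ind_{P'}^G 1` (`FlagCharacter`):
* `classInner_flagChar_eq_card_orbits` — `⟨Ψ, Ψ⟩ = #(P'-orbits on G/P')` (Frobenius reciprocity
  `classInner_indClassFun_left` + Burnside
      `MulAction.sum_card_fixedBy_eq_card_orbits_mul_card_group`);
* `card_orbits_le` — `#(P'-orbits on G/P') ≤ (k+1)^k`: by Bruhat (`FlagCharacter.exists_perm_orbit`)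
  every orbit contains a permutation coset `w(τ)P'`, and the orbit of `w(τ)P'` only depends on the
  invariant `a ↦ min (τ a) k` (`a < k`), a map `Fin k → Fin (k+1)`: two permutations with the same
  invariant satisfy `τ' = α τ β` with `α`, `β` fixing `e_1, …, e_k` (`exists_fixPerm`, the
  permutation `α` built with `Equiv.extendSubtype`), and such permutation matrices lie in `P'`.
  (The exact count is the number of partial injections `[k] ⇀ [k]`; the crude bound `(k+1)^k`
  suffices for a threshold logarithmic in `k`.)
* `classInner_flagChar_le` — **`⟨Ψ, Ψ⟩ ≤ (k+1)^k`**.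
-/

set_option linter.dupNamespace false

noncomputable section

open scoped BigOperators Matrix Classical
open Literature.RepresentationTheory.FiniteGroups

namespace Summit.MatrixMultiplication.MatrixMultiplication.Theorems.SubgroupIdentityDesigns.Negative
namespace FlagOrbits

open GrassmannOrbits (permGL permGL_mul)
open FlagCharacter (flagStab flagChar flagChar_apply permGL_mem_flagStab exists_perm_orbit)

variable {F : Type} [Field F] [Fintype F] [DecidableEq F] {k l : ℕ}

/-! ## The invariant: permutations with the same first-block pattern -/

/-- The invariant of `τ`: `a ↦ min (τ a) k` for `a < k` (the value `τ a` if it lies in the first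
block, else the symbol `k`). -/
def inv (τ : Equiv.Perm (Fin (k + l))) : Fin k → Fin (k + 1) := fun a =>
  ⟨min ((τ (Fin.castAdd l a) : Fin (k + l)) : ℕ) k, Nat.lt_succ_of_le (min_le_right _ _)⟩

omit [Fintype F] [DecidableEq F] in
/-- Equal invariants: for `a < k`, `τ a < k ↔ τ' a < k`, and then `τ a = τ' a`. -/
theorem agree_of_inv_eq {τ τ' : Equiv.Perm (Fin (k + l))} (h : inv (k := k) (l := l) τ = inv τ')
    (a : Fin (k + l)) (ha : (a : ℕ) < k) :
    (((τ a : Fin (k + l)) : ℕ) < k ↔ ((τ' a : Fin (k + l)) : ℕ) < k) ∧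
      (((τ a : Fin (k + l)) : ℕ) < k → τ a = τ' a) := by
  have hc : Fin.castAdd l (⟨a, ha⟩ : Fin k) = a := Fin.ext rfl
  have hm : min ((τ a : Fin (k + l)) : ℕ) k = min ((τ' a : Fin (k + l)) : ℕ) k := by
    have := congrArg Fin.val (congrFun h ⟨a, ha⟩)
    simpa only [inv, hc] using this
  constructor
  · constructor
    · intro h1
      by_contra h2
      rw [min_eq_left h1.le, min_eq_right (not_lt.mp h2)] at hm
      omega
    · intro h1
      by_contra h2
      rw [min_eq_right (not_lt.mp h2), min_eq_left h1.le] at hm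
      omega
  · intro h1
    by_cases h2 : ((τ' a : Fin (k + l)) : ℕ) < k
    · rw [min_eq_left h1.le, min_eq_left h2.le] at hm
      exact Fin.ext hm
    · rw [min_eq_left h1.le, min_eq_right (not_lt.mp h2)] at hm
      omega

omit [Fintype F] [DecidableEq F] in
/-- Equal invariants, `x < k` and `σ'⁻¹ x < k` ⇒ `σ⁻¹ x = σ'⁻¹ x`. -/
theorem inv_apply_eq {σ σ' : Equiv.Perm (Fin (k + l))} (h : inv (k := k) (l := l) σ = inv σ')
    (x : Fin (k + l)) (hx : (x : ℕ) < k) (hx' : ((σ'⁻¹ x : Fin (k + l)) : ℕ) < k) :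
    σ⁻¹ x = σ'⁻¹ x := by
  obtain ⟨h1, h2⟩ := agree_of_inv_eq h (σ'⁻¹ x) hx'
  have e' : σ' (σ'⁻¹ x) = x := σ'.apply_symm_apply x
  rw [e'] at h1 h2
  have e : σ (σ'⁻¹ x) = x := h2 (h1.mpr hx)
  calc σ⁻¹ x = σ⁻¹ (σ (σ'⁻¹ x)) := by rw [e]
    _ = σ'⁻¹ x := by rw [Equiv.Perm.inv_def σ, Equiv.symm_apply_apply]

omit [Fintype F] [DecidableEq F] in
/-- **Extension**: equal invariants ⇒ some permutation `α` fixing the first block pointwise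
carries `σ a ↦ σ' a` for all `a < k`. -/
theorem exists_perm_of_inv_eq {σ σ' : Equiv.Perm (Fin (k + l))}
    (h : inv (k := k) (l := l) σ = inv σ') :
    ∃ α : Equiv.Perm (Fin (k + l)), (∀ x : Fin (k + l), (x : ℕ) < k → α x = x) ∧
      ∀ a : Fin (k + l), (a : ℕ) < k → α (σ a) = σ' a := by
  let P : Fin (k + l) → Prop := fun x => (x : ℕ) < k ∨ ((σ⁻¹ x : Fin (k + l)) : ℕ) < k
  let Q : Fin (k + l) → Prop := fun y => (y : ℕ) < k ∨ ((σ'⁻¹ y : Fin (k + l)) : ℕ) < k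
  -- the explicit bijection `{P} ≃ {Q}`
  let f : {x // P x} → {y // Q y} := fun x =>
    if hx : ((σ⁻¹ (x : Fin (k + l)) : Fin (k + l)) : ℕ) < k then
      ⟨σ' (σ⁻¹ (x : Fin (k + l))), Or.inr (by
        rw [Equiv.Perm.inv_def, Equiv.symm_apply_apply]; exact hx)⟩
    else ⟨(x : Fin (k + l)), Or.inl (x.2.resolve_right hx)⟩
  let g : {y // Q y} → {x // P x} := fun y =>
    if hy : ((σ'⁻¹ (y : Fin (k + l)) : Fin (k + l)) : ℕ) < k then
      ⟨σ (σ'⁻¹ (y : Fin (k + l))), Or.inr (by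
        rw [Equiv.Perm.inv_def, Equiv.symm_apply_apply]; exact hy)⟩
    else ⟨(y : Fin (k + l)), Or.inl (y.2.resolve_right hy)⟩
  have hgf : Function.LeftInverse g f := by
    rintro ⟨x, hxP⟩
    by_cases hx : ((σ⁻¹ x : Fin (k + l)) : ℕ) < k
    · have hy : ((σ'⁻¹ (σ' (σ⁻¹ x)) : Fin (k + l)) : ℕ) < k := by
        rw [Equiv.Perm.inv_def σ', Equiv.symm_apply_apply]; exact hx
      apply Subtype.ext
      simp only [f, g, dif_pos hx, dif_pos hy]
      rw [Equiv.Perm.inv_def σ', Equiv.symm_apply_apply, Equiv.Perm.inv_def,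
        Equiv.apply_symm_apply]
    · have hxk : (x : ℕ) < k := hxP.resolve_right hx
      have hy : ¬ ((σ'⁻¹ x : Fin (k + l)) : ℕ) < k := fun hy =>
        hx (by rw [inv_apply_eq h x hxk hy]; exact hy)
      apply Subtype.ext
      simp only [f, g, dif_neg hx, dif_neg hy]
  have hfg : Function.RightInverse g f := by
    rintro ⟨y, hyQ⟩
    by_cases hy : ((σ'⁻¹ y : Fin (k + l)) : ℕ) < k
    · have hx : ((σ⁻¹ (σ (σ'⁻¹ y)) : Fin (k + l)) : ℕ) < k := by
        rw [Equiv.Perm.inv_def σ, Equiv.symm_apply_apply]; exact hy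
      apply Subtype.ext
      simp only [f, g, dif_pos hy, dif_pos hx]
      rw [Equiv.Perm.inv_def σ, Equiv.symm_apply_apply, Equiv.Perm.inv_def,
        Equiv.apply_symm_apply]
    · have hyk : (y : ℕ) < k := hyQ.resolve_right hy
      have hx : ¬ ((σ⁻¹ y : Fin (k + l)) : ℕ) < k := fun hx =>
        hy (by rw [inv_apply_eq h.symm y hyk hx]; exact hx)
      apply Subtype.ext
      simp only [f, g, dif_neg hy, dif_neg hx]
  let e : {x // P x} ≃ {y // Q y} := ⟨f, g, hgf, hfg⟩
  refine ⟨e.extendSubtype, fun x hx => ?_, fun a ha => ?_⟩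
  · have hP : P x := Or.inl hx
    rw [e.extendSubtype_apply_of_mem x hP]
    show ((f ⟨x, hP⟩ : {y // Q y}) : Fin (k + l)) = x
    by_cases hx' : ((σ⁻¹ x : Fin (k + l)) : ℕ) < k
    · simp only [f, dif_pos hx']
      obtain ⟨h1, h2⟩ := agree_of_inv_eq h (σ⁻¹ x) hx'
      have e1 : σ (σ⁻¹ x) = x := σ.apply_symm_apply x
      rw [e1] at h1 h2
      exact (h2 hx).symm
    · simp only [f, dif_neg hx']
  · have hP : P (σ a) := Or.inr (by rw [Equiv.Perm.inv_def, Equiv.symm_apply_apply]; exact ha)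
    rw [e.extendSubtype_apply_of_mem _ hP]
    show ((f ⟨σ a, hP⟩ : {y // Q y}) : Fin (k + l)) = σ' a
    have ha' : ((σ⁻¹ (σ a) : Fin (k + l)) : ℕ) < k := by
      rw [Equiv.Perm.inv_def, Equiv.symm_apply_apply]; exact ha
    simp only [f, dif_pos ha']
    rw [Equiv.Perm.inv_def, Equiv.symm_apply_apply]

omit [Fintype F] [DecidableEq F] in
/-- **Equal invariants ⇒ `σ' = α σ β`** with `α`, `β` fixing the first block pointwise. -/
theorem exists_fixPerm {σ σ' : Equiv.Perm (Fin (k + l))} (h : inv (k := k) (l := l) σ = inv σ') :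
    ∃ α β : Equiv.Perm (Fin (k + l)), (∀ j : Fin k, α (Fin.castAdd l j) = Fin.castAdd l j) ∧
      (∀ j : Fin k, β (Fin.castAdd l j) = Fin.castAdd l j) ∧ σ' = α * σ * β := by
  obtain ⟨α, hfix, hcarry⟩ := exists_perm_of_inv_eq h
  refine ⟨α, σ⁻¹ * α⁻¹ * σ', fun j => hfix _ (by simp), fun j => ?_, by group⟩
  have hc := hcarry (Fin.castAdd l j) (by simp)
  show σ⁻¹ (α⁻¹ (σ' (Fin.castAdd l j))) = Fin.castAdd l j
  rw [← hc, Equiv.Perm.inv_def α, Equiv.symm_apply_apply, Equiv.Perm.inv_def,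
    Equiv.symm_apply_apply]

/-! ## The orbit count -/

omit [Fintype F] in
/-- Equal invariants ⇒ the permutation cosets lie in one `P'`-orbit. -/
theorem perm_mem_orbit {τ τ' : Equiv.Perm (Fin (k + l))} (h : inv (k := k) (l := l) τ = inv τ') :
    ((permGL τ' : GL (Fin (k + l)) F) : GL (Fin (k + l)) F ⧸ flagStab F k l) ∈
      MulAction.orbit (flagStab F k l)
        ((permGL τ : GL (Fin (k + l)) F) : GL (Fin (k + l)) F ⧸ flagStab F k l) := by
  obtain ⟨α, β, hα, hβ, rfl⟩ := exists_fixPerm h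
  refine MulAction.mem_orbit_iff.mpr ⟨⟨permGL α, permGL_mem_flagStab hα⟩, ?_⟩
  show ((((permGL α : GL (Fin (k + l)) F) * permGL τ : GL (Fin (k + l)) F)) :
      GL (Fin (k + l)) F ⧸ flagStab F k l) =
      ((permGL (α * τ * β) : GL (Fin (k + l)) F) : GL (Fin (k + l)) F ⧸ flagStab F k l)
  rw [permGL_mul, permGL_mul, QuotientGroup.mk_mul_of_mem _ (permGL_mem_flagStab hβ)]

/-- **`#(P'-orbits on G/P') ≤ (k+1)^k`.** -/
theorem card_orbits_le :
    Fintype.card (Quotient (MulAction.orbitRel (flagStab F k l)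
        (GL (Fin (k + l)) F ⧸ flagStab F k l))) ≤ (k + 1) ^ k := by
  have hrep : ∀ o : Quotient (MulAction.orbitRel (flagStab F k l)
      (GL (Fin (k + l)) F ⧸ flagStab F k l)), ∃ τ : Equiv.Perm (Fin (k + l)),
      o = Quotient.mk _ ((permGL τ : GL (Fin (k + l)) F) : GL (Fin (k + l)) F ⧸ flagStab F k l)
      := by
    intro o
    induction o using Quotient.inductionOn with
    | h q =>
      obtain ⟨τ, s, hs⟩ := exists_perm_orbit (F := F) (k := k) (l := l) q.out
      rw [QuotientGroup.out_eq'] at hs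
      exact ⟨τ, Quotient.sound (MulAction.orbitRel_apply.mpr
        (MulAction.mem_orbit_iff.mpr ⟨s, hs⟩))⟩
  choose τ hτ using hrep
  let J : Quotient (MulAction.orbitRel (flagStab F k l) (GL (Fin (k + l)) F ⧸ flagStab F k l)) →
      (Fin k → Fin (k + 1)) := fun o => inv (τ o)
  have hJ : Function.Injective J := by
    intro o o' h
    rw [hτ o, hτ o']
    exact (Quotient.sound (MulAction.orbitRel_apply.mpr (perm_mem_orbit h))).symm
  have := Fintype.card_le_of_injective J hJ
  rwa [Fintype.card_fun, Fintype.card_fin, Fintype.card_fin] at this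

/-! ## The norm of `Ψ` -/

/-- `Ψ(s⁻¹) = #Fix(s)` on `G/P'`. -/
theorem flagChar_inv_apply (s : flagStab F k l) :
    flagChar F k l ((s⁻¹ : flagStab F k l) : GL (Fin (k + l)) F) =
      ((Finset.univ.filter fun q : GL (Fin (k + l)) F ⧸ flagStab F k l => s • q = q).card : ℂ)
    := by
  rw [flagChar_apply, Finset.natCast_card_filter]
  refine Finset.sum_congr rfl fun q _ => ?_
  congr 1
  simp only [Subgroup.coe_inv, eq_iff_iff]
  rw [inv_smul_eq_iff]
  exact ⟨fun h => h.symm, fun h => h.symm⟩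

/-- **Frobenius + Burnside**: `⟨Ψ, Ψ⟩ = #(P'-orbits on G/P')`. -/
theorem classInner_flagChar_eq_card_orbits :
    classInner (flagChar F k l) (flagChar F k l) =
      (Fintype.card (Quotient (MulAction.orbitRel (flagStab F k l)
          (GL (Fin (k + l)) F ⧸ flagStab F k l))) : ℂ) := by
  unfold flagChar
  rw [classInner_indClassFun_left _ _ (isClassFun_indClassFun _ _), classInner_apply]
  have hterm : ∀ s : flagStab F k l, (fun _ : flagStab F k l => (1 : ℂ)) s *
      (fun x : flagStab F k l => indClassFun (flagStab F k l) (fun _ => (1 : ℂ)) x) s⁻¹ =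
        ((Finset.univ.filter fun q : GL (Fin (k + l)) F ⧸ flagStab F k l => s • q = q).card : ℂ)
      := by
    intro s
    rw [one_mul]
    exact flagChar_inv_apply s
  rw [Finset.sum_congr rfl fun s _ => hterm s, ← Nat.cast_sum]
  have hfix : ∀ s : flagStab F k l, Fintype.card (MulAction.fixedBy
      (GL (Fin (k + l)) F ⧸ flagStab F k l) s) =
      (Finset.univ.filter fun q : GL (Fin (k + l)) F ⧸ flagStab F k l => s • q = q).card := by
    intro s
    rw [← Set.toFinset_card]
    congr 1
    ext q
    simp [MulAction.mem_fixedBy]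
  rw [← Finset.sum_congr rfl fun s _ => hfix s,
    MulAction.sum_card_fixedBy_eq_card_orbits_mul_card_group (flagStab F k l)
      (GL (Fin (k + l)) F ⧸ flagStab F k l), Nat.cast_mul]
  have hc : (Fintype.card (flagStab F k l) : ℂ) ≠ 0 := Nat.cast_ne_zero.mpr Fintype.card_ne_zero
  rw [mul_comm ((Fintype.card (Quotient (MulAction.orbitRel (flagStab F k l)
      (GL (Fin (k + l)) F ⧸ flagStab F k l))) : ℂ)), ← mul_assoc, inv_mul_cancel₀ hc, one_mul]

/-- **`⟨Ψ, Ψ⟩ ≤ (k+1)^k`.** -/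
theorem classInner_flagChar_le :
    (classInner (flagChar F k l) (flagChar F k l)).re ≤ (((k + 1) ^ k : ℕ) : ℝ) := by
  rw [classInner_flagChar_eq_card_orbits, Complex.natCast_re]
  exact_mod_cast card_orbits_le (F := F) (k := k) (l := l)

end FlagOrbits
end Summit.MatrixMultiplication.MatrixMultiplication.Theorems.SubgroupIdentityDesigns.Negative
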